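import Mathlib.Analysis.InnerProductSpace.PiL2
import Mathlib.Analysis.SpecialFunctions.Pow.Real
import Literature.Probability.LatticeModels.ConformalCovariance
import HarnessLib

-- provenance: harness21/H21/H21/Prelude/StatMech/CFTData.lean @ a991ad1 (interim HEAD d8f2665); M5 mechanical rewrite
/-!
# Statement-level Euclidean CFT data in `d` dimensions

Trunk: StatMech (prelude item P28 `CFTData`, review point R8, tier L; notion `cft_data_ope`).

We record, at statement level, the data of a (putative) unitary Euclidean conformal field
theory in `d` dimensions in the sense of the conformal bootstrap literature:

* a *primary spectrum* (`PrimarySpectrum`): an index type `ι` of primary operators `𝒪ᵢ` with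
  scaling dimensions `Δᵢ : ℝ`, spins `ℓᵢ : ℕ` (symmetric traceless tensors only), a global
  `ℤ₂`-charge `z2Odd i : Bool` and a distinguished identity operator `unit` (`Δ = 0`, `ℓ = 0`,
  `ℤ₂`-even);
* `CFTData d`: the spectrum together with OPE coefficients `ope i j k = λ_{ijk} ∈ ℝ` and, for each
  `i`, the family `corr i : CorrFamily d` of Euclidean `n`-point functions
  `⟨𝒪ᵢ(x₁) ⋯ 𝒪ᵢ(xₙ)⟩` of `n` identical copies of `𝒪ᵢ` (meaningful for scalar `𝒪ᵢ`; see
  `Literature.Prelude.StatMech.ScalingLimit` for `CorrFamily`).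

On this data we define the axioms as `Prop`s: well-formedness of the spectrum
(`PrimarySpectrum.IsWellFormed`), Möbius covariance of the scalar correlators
(`CFTData.IsCovariant`, via `IsMoebiusCovariant` of `Literature.Prelude.StatMech.ConformalCovariance`),
the unitarity bounds `Δ ≥ (d-2)/2` (scalars), `Δ ≥ ℓ + d - 2` (spin `ℓ ≥ 1`)
(`CFTData.SatisfiesUnitarityBounds`), global `ℤ₂` symmetry (`CFTData.IsZ2Symmetric`),
Osterwalder–Schrader reflection positivity of each scalar family (`CFTData.IsOSPositive`), the
two-point normalisation `⟨𝒪(x)𝒪(y)⟩ = |x-y|^{-2Δ}` (`CFTData.twoPointNormalised`), and their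
conjunction `IsUnitaryCFTData`. We also define the conformal cross-ratios
`u = x₁₂² x₃₄² / (x₁₃² x₂₄²)`, `v = x₁₄² x₂₃² / (x₁₃² x₂₄²)` (`crossRatioU`, `crossRatioV`).

Sources: D. Poland, S. Rychkov, A. Vichi, *The conformal bootstrap: theory, numerical techniques,
and applications*, Rev. Mod. Phys. 91 (2019) 015002, §§II–III (primaries, unitarity bounds
eq. (19), OPE §II.E, two-point normalisation eq. (30), cross-ratios eq. (36), reflection
positivity §III.B); P. Kravchuk, J. Qiao, S. Rychkov, *Distributions in CFT II. Minkowski space*,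
Commun. Math. Phys. 386 (2021), §2 (Euclidean CFT axioms: conformal invariance, OS reflection
positivity, OPE); K. Osterwalder, R. Schrader, Commun. Math. Phys. 31 (1973), axiom (E2).

Mathlib anchors used (searched): `EuclideanSpace`, `WithLp.toLp`, `Real.rpow`, `Fin.append`,
`Finset.sum`, `Bool.xor`. Mathlib has no CFT data, unitarity bounds, OPE coefficients or
conformal cross-ratios (searched `crossRatio`, `CFT`, `unitarity`, `PrimarySpectrum`). H21 has
the unrelated *real* four-point cross-ratio `Literature.crossRatio : (Fin 4 → ℝ) → ℝ` (Cardy's `η`,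
`Literature.Prelude.Stoch.ConformalRectangle`); the present `crossRatioU`/`crossRatioV` live in
`Literature.StatMech`, take points of `ℝ^d` and are the squared-distance ratios `u, v` of the bootstrap.

Design choices.
* `PrimarySpectrum.ι : Type` is a field (so `PrimarySpectrum : Type 1`); spectra may be infinite.
* Only `n`-point functions of identical scalars are recorded (`corr i`), which is what the
  target statements (crit-ising S23/S24: `⟨σ…σ⟩`, `⟨ε…ε⟩`) consume; mixed correlators and
  spinning correlators are not part of v0. Accordingly `IsOSPositive` is reflection positivity of
  each scalar family separately (a consequence of, not equivalent to, full OS positivity).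
* Reflection positivity is written pointwise with finite real linear combinations
  (`Finset.sum` over `Fin k`), the Schwinger functions being real: for points in the open
  half-space `{x₀ > 0}` and `θ` the reflection in the hyperplane `x₀ = 0` (`timeReflection`),
  `∑_{a,b} c_a c_b S_{nₐ+n_b}(θxₐ, x_b) ≥ 0`. For `d = 0` the half-space condition is vacuous and
  `θ = id` (harmless junk; all uses have `d ≥ 2`).
* Unitarity bounds are stated in `ℝ` (`(d - 2)/2`, `ℓ + d - 2` with real subtraction), avoiding
  `ℕ` subtraction.
* `crossRatioU`/`crossRatioV` use real division (junk value `0` at coincident points, where they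
  are never evaluated in statements).
-/

namespace Literature.Probability.LatticeModels

open Finset

/-! ### Primary spectra -/

/-- The spectrum of primary operators of a `d`-dimensional CFT, at statement level: an index type
`ι` of primaries `𝒪ᵢ`, their scaling dimensions `Δ i : ℝ`, spins `spin i : ℕ` (rank of the
symmetric traceless Lorentz/rotation representation), global `ℤ₂` charge `z2Odd i` (`true` for
`ℤ₂`-odd operators such as the Ising spin field `σ`), and the identity operator `unit`.
(Poland–Rychkov–Vichi, Rev. Mod. Phys. 91 (2019), §II.A–II.B, "CFT data".) [folklore] -/
structure PrimarySpectrum where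
  /-- The index type of primary operators. -/
  ι : Type
  /-- Scaling dimensions `Δᵢ`. -/
  Δ : ι → ℝ
  /-- Spins `ℓᵢ` (symmetric traceless tensor rank). -/
  spin : ι → ℕ
  /-- Global `ℤ₂` charge: `true` iff the operator is `ℤ₂`-odd. -/
  z2Odd : ι → Bool
  /-- The identity operator `𝟙`. -/
  unit : ι

namespace PrimarySpectrum

/-- A primary spectrum is *well formed* if the identity has `Δ = 0`, spin `0` and is `ℤ₂`-even,
and every other primary has strictly positive scaling dimension (as in a unitary CFT with a
unique vacuum). (Poland–Rychkov–Vichi 2019, §II.B–II.C.) [cite: PolandRychkovVichi2019, §II.B–II.C] -/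
def IsWellFormed (S : PrimarySpectrum) : Prop :=
  S.Δ S.unit = 0 ∧ S.spin S.unit = 0 ∧ S.z2Odd S.unit = false ∧ ∀ i, i ≠ S.unit → 0 < S.Δ i

/-- A primary `𝒪ᵢ` is *relevant* in `d` dimensions if `Δᵢ < d`.
(Poland–Rychkov–Vichi 2019, §II.A and §V.B, relevant operators of the 3d Ising CFT.) [cite: PolandRychkovVichi2019, §II.A and §V.B  relevant operators of th] -/
def IsRelevant (d : ℕ) (S : PrimarySpectrum) (i : S.ι) : Prop :=
  S.Δ i < d

/-- The set of scalar primaries (`spin = 0`). (Poland–Rychkov–Vichi 2019, §II.B.) [cite: PolandRychkovVichi2019, §II.B] -/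
def scalars (S : PrimarySpectrum) : Set S.ι :=
  {i | S.spin i = 0}

/-- Membership in `scalars`. (Poland–Rychkov–Vichi 2019, §II.B.) [cite: PolandRychkovVichi2019, §II.B] -/
@[simp] theorem mem_scalars (S : PrimarySpectrum) (i : S.ι) : i ∈ S.scalars ↔ S.spin i = 0 :=
  Iff.rfl

/-- In a well-formed spectrum the identity is a scalar. (Poland–Rychkov–Vichi 2019, §II.B.) [cite: PolandRychkovVichi2019, §II.B] -/
theorem IsWellFormed.unit_mem_scalars {S : PrimarySpectrum} (h : S.IsWellFormed) :
    S.unit ∈ S.scalars :=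
  h.2.1

/-- In a well-formed spectrum all scaling dimensions are non-negative.
(Poland–Rychkov–Vichi 2019, §II.C.) [cite: PolandRychkovVichi2019, §II.C] -/
theorem IsWellFormed.delta_nonneg {S : PrimarySpectrum} (h : S.IsWellFormed) (i : S.ι) :
    0 ≤ S.Δ i := by
  by_cases hi : i = S.unit
  · rw [hi, h.1]
  · exact le_of_lt (h.2.2.2 i hi)

end PrimarySpectrum

/-! ### Geometry: time reflection, half-space, cross-ratios -/

variable {d : ℕ}

/-- The Osterwalder–Schrader time reflection `θ (x₀, x⃗) = (-x₀, x⃗)` of `ℝ^d`, reflection in the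
hyperplane `x₀ = 0` (the identity when `d = 0`). (Osterwalder–Schrader, Commun. Math. Phys. 31
(1973), §2; Kravchuk–Qiao–Rychkov, Commun. Math. Phys. 386 (2021), §2.1.) [folklore] -/
noncomputable def timeReflection (x : EuclideanSpace ℝ (Fin d)) : EuclideanSpace ℝ (Fin d) :=
  WithLp.toLp 2 fun j => if j.val = 0 then -x j else x j

/-- Coordinates of the time reflection. (Osterwalder–Schrader 1973, §2.) [cite: OsterwalderSchrader1973, §2] -/
@[simp] theorem timeReflection_apply (x : EuclideanSpace ℝ (Fin d)) (j : Fin d) :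
    timeReflection x j = if j.val = 0 then -x j else x j := rfl

/-- The time reflection is an involution. (Osterwalder–Schrader 1973, §2.) [cite: OsterwalderSchrader1973, §2] -/
theorem timeReflection_involutive : Function.Involutive (timeReflection (d := d)) := by
  intro x
  ext j
  simp only [timeReflection_apply]
  split_ifs <;> simp

/-- The open positive half-space `{x ∈ ℝ^d | x₀ > 0}` (all of `ℝ^0` when `d = 0`).
(Osterwalder–Schrader 1973, §2; Kravchuk–Qiao–Rychkov 2021, §2.1.) [cite: OsterwalderSchrader1973, §2] -/
def positiveHalfSpace (d : ℕ) : Set (EuclideanSpace ℝ (Fin d)) :=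
  {x | ∀ j : Fin d, j.val = 0 → 0 < x j}

/-- Membership in the positive half-space. (Osterwalder–Schrader 1973, §2.) [cite: OsterwalderSchrader1973, §2] -/
@[simp] theorem mem_positiveHalfSpace (x : EuclideanSpace ℝ (Fin d)) :
    x ∈ positiveHalfSpace d ↔ ∀ j : Fin d, j.val = 0 → 0 < x j := Iff.rfl

/-- The conformal cross-ratio `u = (x₁₂² x₃₄²) / (x₁₃² x₂₄²)` of four points of `ℝ^d`
(`xᵢⱼ = ‖xᵢ - xⱼ‖`; indices `0,1,2,3` here). Junk value by real division at coincident points.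
(Poland–Rychkov–Vichi 2019, §II.D, eq. (36).) [cite: PolandRychkovVichi2019, §II.D  eq. (36] -/
noncomputable def crossRatioU (x : Fin 4 → EuclideanSpace ℝ (Fin d)) : ℝ :=
  (‖x 0 - x 1‖ ^ 2 * ‖x 2 - x 3‖ ^ 2) / (‖x 0 - x 2‖ ^ 2 * ‖x 1 - x 3‖ ^ 2)

/-- The conformal cross-ratio `v = (x₁₄² x₂₃²) / (x₁₃² x₂₄²)` of four points of `ℝ^d`
(`xᵢⱼ = ‖xᵢ - xⱼ‖`; indices `0,1,2,3` here). Junk value by real division at coincident points.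
(Poland–Rychkov–Vichi 2019, §II.D, eq. (36).) [cite: PolandRychkovVichi2019, §II.D  eq. (36] -/
noncomputable def crossRatioV (x : Fin 4 → EuclideanSpace ℝ (Fin d)) : ℝ :=
  (‖x 0 - x 3‖ ^ 2 * ‖x 1 - x 2‖ ^ 2) / (‖x 0 - x 2‖ ^ 2 * ‖x 1 - x 3‖ ^ 2)

/-- Exchanging `x₂ ↔ x₄` (indices `1 ↔ 3` here) exchanges `u` and `v` — the crossing
transformation of the bootstrap.
(Poland–Rychkov–Vichi 2019, §III.A, eq. (44), `u ↔ v`.) [cite: PolandRychkovVichi2019, §III.A  eq. (44] -/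
theorem crossRatioU_swap (x : Fin 4 → EuclideanSpace ℝ (Fin d)) :
    crossRatioU ![x 0, x 3, x 2, x 1] = crossRatioV x := by
  simp only [crossRatioU, crossRatioV, Matrix.cons_val_zero, Matrix.cons_val_one,
    Matrix.cons_val]
  rw [norm_sub_rev (x 2) (x 1), norm_sub_rev (x 3) (x 1)]

/-- Both cross-ratios are non-negative. (Poland–Rychkov–Vichi 2019, §II.D.) [cite: PolandRychkovVichi2019, §II.D] -/
theorem crossRatioU_nonneg (x : Fin 4 → EuclideanSpace ℝ (Fin d)) : 0 ≤ crossRatioU x := by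
  unfold crossRatioU; positivity

/-- Both cross-ratios are non-negative. (Poland–Rychkov–Vichi 2019, §II.D.) [cite: PolandRychkovVichi2019, §II.D] -/
theorem crossRatioV_nonneg (x : Fin 4 → EuclideanSpace ℝ (Fin d)) : 0 ≤ crossRatioV x := by
  unfold crossRatioV; positivity

/-! ### CFT data and axioms -/

/-- Statement-level data of a `d`-dimensional Euclidean CFT: a primary spectrum together with
real OPE coefficients `ope i j k = λ_{ijk}` (the coefficient of `𝒪ₖ` in `𝒪ᵢ × 𝒪ⱼ`) and, for
each primary `i`, the family `corr i n (x₁,…,xₙ) = ⟨𝒪ᵢ(x₁) ⋯ 𝒪ᵢ(xₙ)⟩` of Euclidean `n`-point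
functions of `n` identical copies of `𝒪ᵢ` (used for scalar `𝒪ᵢ`).
(Poland–Rychkov–Vichi 2019, §II.B "CFT data" and §II.E (OPE); Kravchuk–Qiao–Rychkov 2021, §2.) [cite: PolandRychkovVichi2019, §II.B "CFT data" and §II.E (OPE] -/
structure CFTData (d : ℕ) extends PrimarySpectrum where
  /-- OPE coefficients `λ_{ijk}`. -/
  ope : ι → ι → ι → ℝ
  /-- `n`-point functions of identical copies of the primary `i`. -/
  corr : ι → CorrFamily d

namespace CFTData

/-- Conformal covariance: the `n`-point functions of every scalar primary `𝒪ᵢ` are Möbius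
covariant with scaling dimension `Δᵢ` (`IsMoebiusCovariant`).
(Poland–Rychkov–Vichi 2019, §II.A, eq. (7); Di Francesco–Mathieu–Sénéchal 1997, eq. (4.62).) [cite: PolandRychkovVichi2019, §II.A  eq. (7] -/
def IsCovariant (D : CFTData d) : Prop :=
  ∀ i, D.spin i = 0 → IsMoebiusCovariant (D.Δ i) (D.corr i)

/-- The unitarity bounds: every non-identity primary satisfies `Δ ≥ (d - 2)/2` if it is a scalar
and `Δ ≥ ℓ + d - 2` if it has spin `ℓ ≥ 1` (real arithmetic).
(Poland–Rychkov–Vichi 2019, §II.C, eq. (19).) [cite: PolandRychkovVichi2019, §II.C  eq. (19] -/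
def SatisfiesUnitarityBounds (D : CFTData d) : Prop :=
  ∀ i, i ≠ D.unit →
    (D.spin i = 0 → ((d : ℝ) - 2) / 2 ≤ D.Δ i) ∧
      (1 ≤ D.spin i → (D.spin i : ℝ) + d - 2 ≤ D.Δ i)

/-- Global `ℤ₂` symmetry: `n`-point functions of a `ℤ₂`-odd primary vanish for odd `n`, and the
OPE coefficient `λ_{ijk}` vanishes unless the `ℤ₂` charges of `i, j, k` multiply to `+1`
(i.e. an even number of them are odd). (Poland–Rychkov–Vichi 2019, §V.B (3d Ising, `ℤ₂`-even /
odd sectors) and §II.E.) [cite: PolandRychkovVichi2019, §V.B (3d Ising   ℤ₂ -even / odd sectors] -/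
def IsZ2Symmetric (D : CFTData d) : Prop :=
  (∀ i, D.z2Odd i = true → ∀ n, Odd n → ∀ x, D.corr i n x = 0) ∧
    ∀ i j k, (D.z2Odd i ^^ D.z2Odd j ^^ D.z2Odd k) = true → D.ope i j k = 0

/-- Osterwalder–Schrader reflection positivity of the scalar families, pointwise form: for every
scalar `i`, every finite family of configurations `xₐ ∈ (ℝ^d)^{nₐ}` in the open half-space
`{x₀ > 0}` and real coefficients `cₐ`,
`∑_{a,b} cₐ c_b ⟨𝒪ᵢ(θxₐ,₁)⋯𝒪ᵢ(θxₐ,ₙₐ) 𝒪ᵢ(x_b,₁)⋯𝒪ᵢ(x_b,ₙ_b)⟩ ≥ 0`, `θ = timeReflection`.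
(Osterwalder–Schrader, Commun. Math. Phys. 31 (1973), axiom (E2); Kravchuk–Qiao–Rychkov 2021,
§2.1; Poland–Rychkov–Vichi 2019, §III.B.) [cite: KravchukQiaoRychkov2021, §2.1] -/
def IsOSPositive (D : CFTData d) : Prop :=
  ∀ i, D.spin i = 0 → ∀ (k : ℕ) (n : Fin k → ℕ)
    (x : (a : Fin k) → Fin (n a) → EuclideanSpace ℝ (Fin d)) (c : Fin k → ℝ),
    (∀ a j, x a j ∈ positiveHalfSpace d) →
      0 ≤ ∑ a, ∑ b, c a * c b *
        D.corr i (n a + n b) (Fin.append (fun j => timeReflection (x a j)) (x b))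

/-- Two-point normalisation of scalar primaries: `⟨𝒪ᵢ(x) 𝒪ᵢ(y)⟩ = ‖x - y‖^{-2Δᵢ}` for `x ≠ y`.
(Poland–Rychkov–Vichi 2019, §II.D, eq. (30).) [cite: PolandRychkovVichi2019, §II.D  eq. (30] -/
def twoPointNormalised (D : CFTData d) : Prop :=
  ∀ i, D.spin i = 0 → ∀ x y : EuclideanSpace ℝ (Fin d), x ≠ y →
    D.corr i 2 ![x, y] = ‖x - y‖ ^ (-2 * D.Δ i)

end CFTData

/-- Unitary CFT data: well-formed spectrum, Möbius-covariant scalar correlators, unitarity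
bounds, OS reflection positivity and normalised two-point functions.
(Poland–Rychkov–Vichi 2019, §§II–III; Kravchuk–Qiao–Rychkov 2021, §2.) [cite: PolandRychkovVichi2019, §§II–III] -/
def IsUnitaryCFTData (D : CFTData d) : Prop :=
  D.IsWellFormed ∧ D.IsCovariant ∧ D.SatisfiesUnitarityBounds ∧ D.IsOSPositive ∧
    D.twoPointNormalised

namespace IsUnitaryCFTData

variable {D : CFTData d}

/-- Unitary CFT data have a well-formed spectrum. (Poland–Rychkov–Vichi 2019, §II.B.) [cite: PolandRychkovVichi2019, §II.B] -/
theorem isWellFormed (h : IsUnitaryCFTData D) : D.IsWellFormed := h.1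

/-- Unitary CFT data are conformally covariant. (Poland–Rychkov–Vichi 2019, §II.A.) [cite: PolandRychkovVichi2019, §II.A] -/
theorem isCovariant (h : IsUnitaryCFTData D) : D.IsCovariant := h.2.1

/-- Unitary CFT data satisfy the unitarity bounds. (Poland–Rychkov–Vichi 2019, §II.C.) [cite: PolandRychkovVichi2019, §II.C] -/
theorem satisfiesUnitarityBounds (h : IsUnitaryCFTData D) : D.SatisfiesUnitarityBounds :=
  h.2.2.1

/-- Unitary CFT data are OS reflection positive. (Poland–Rychkov–Vichi 2019, §III.B.) [cite: PolandRychkovVichi2019, §III.B] -/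
theorem isOSPositive (h : IsUnitaryCFTData D) : D.IsOSPositive := h.2.2.2.1

/-- Unitary CFT data have normalised two-point functions. (Poland–Rychkov–Vichi 2019, §II.D.) [cite: PolandRychkovVichi2019, §II.D] -/
theorem twoPointNormalised (h : IsUnitaryCFTData D) : D.twoPointNormalised := h.2.2.2.2

/-- In unitary CFT data every non-identity scalar has `Δ ≥ (d-2)/2` and `Δ > 0`.
(Poland–Rychkov–Vichi 2019, §II.C, eq. (19).) [cite: PolandRychkovVichi2019, §II.C  eq. (19] -/
theorem delta_pos_of_ne_unit (h : IsUnitaryCFTData D) {i : D.ι} (hi : i ≠ D.unit) :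
    0 < D.Δ i :=
  h.1.2.2.2 i hi

end IsUnitaryCFTData

end Literature.Probability.LatticeModels
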